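import Summits.ResolutionOfSingularities.ResolutionOfSingularities.Theorems.HomologicalConductorNoZenoCompositeSplit
import Summits.ResolutionOfSingularities.ResolutionOfSingularities.Theorems.HomologicalConductorNoZenoCoarseningThread
import Summits.ResolutionOfSingularities.ResolutionOfSingularities.Theorems.HomologicalConductorNoZenoBranchBSurfaceDatum
import Summits.ResolutionOfSingularities.ResolutionOfSingularities.Theorems.HomologicalConductorNoZenoNoetherianCapture
import Literature.AlgebraicGeometry.Resolution.PrimeDivisors
import HarnessLib

/-!
# Crux `NoZenoR` (stmt-ResolutionOfSingularities-19943), slot 3 `stub_noCaZenoChainSharpF`, tr.deg-3 half `E3`: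
# THE SOCLE DICHOTOMY and THE ARITHMETIC OF THE COARSENING

OURS (cell res-hironaka, crux chain W4.4; lead res-L0-w44-lead-1 g10, DESK WORD 43 OBJECT 3-T).  AI-written, weaker than expert review;
nothing here is a statement of the manuscript under review (Hironaka 2017).  SUPPORT-level, counted 0.  Def-free, fact-free.

`E3` = the `h3` binder text of `CompositeSplit.noCaZenoChainSharp_of_split` (p584261): a threadless COMPOSITE kernel datum of transcendence
degree `3` (a proper coarsening `O < O₁ ≠ K` exists) whose tower exhausts `O` has, from some stage on, no `ca`-Zeno chain in the units of
some proper coarsening.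

* `valuation_aeval_eq_one_of_coarsening` — for a coarsening `O ≤ O₁` and `u ∈ 𝔪_O` an `O₁`-UNIT, every non-zero `f ∈ k[X]` has
  `O₁`-value `1` at `u`: the residue of `u` in `κ(O₁)` is transcendental over `k`.  Hence (`exists_residuallyTranscendental_of_lt`) every
  PROPER coarsening has residual transcendence degree `≥ 1`, and (`coarsening_dvr_or_residueTrdeg_eq_one`) in transcendence degree `3` a
  proper coarsening `O₁ ≠ K` is either a DISCRETE VALUATION RING (a prime divisor, `F = 2`) or has `F = 1` — the desk's E3′ clause
  «`¬ IsNoetherianRing ↥O₁ → residueTrdeg k O₁ _ = 1`».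
* `exists_valueRise_of_noetherian` — no infinite strictly value-decreasing sequence inside a noetherian subring of `O` (the ACC argument of THM
  NC); so AFTER A REGULAR STAGE there is no `ca`-Zeno chain at all (`noChain_of_isRegularLocalRing_tower`).
* `e3Conclusion_of_discreteSocle` — THE CLOSED HALF: if SOME coarsening `U > O` has the descending chain condition on the `O`-values of its
  units (the residual valuation `O/𝔪_U` is DISCRETE — «discrete socle»), the threadless kernel tower terminates
  (`Coarsening.kernelThreadless_of_discreteCoarsening`, PROVED) and the E3 conclusion follows.  CAUTION (answer to DW43 (ii)): the input is the
  discreteness of the RESIDUAL valuation, NOT `IsNoetherianRing ↥O₁`; the case `O₁` a prime divisor `E` (a DVR) with `O/𝔪_E` NON-discrete on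
  the surface field `κ(E)` is exactly the declared E3 habitat (registry docstring of `Sig.stub_noCaZenoChain`) and is NOT closed here.
* TEXT LEVEL: `noCaZenoChainSharp3_of_socleSplit : <E3⁺> → <E3>` where `E3⁺` := E3 with the ground-field binder NAMED and two clauses inserted
  after the coarsening binder: (nd) «every proper coarsening `U > O` carries an infinite strictly value-decreasing sequence of `U`-units of `O`»
  (non-discrete socle) and (ar) «every proper coarsening `O₁ ≠ K` that is not noetherian has `residueTrdeg k O₁ = 1`».  OUTCOME: slot-3
  residual of record = {H, E3⁺}.

References: O. Zariski, P. Samuel, *Commutative Algebra* II (1960), Ch. VI §14, Thm. 31 [`ZariskiSamuel1960`] (tree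
`isDiscreteValuationRing_of_residueTrdeg`); S. Abhyankar, Amer. J. Math. 78 (1956) (`ratRank_add_residueTrdeg_le_trdeg`).
-/

noncomputable section

-- single-problem summit: the doubled namespace component `ResolutionOfSingularities` is forced
set_option linter.dupNamespace false

namespace Summit.ResolutionOfSingularities.ResolutionOfSingularities.Theorems.NoZeno.CompositeSplit

open Summit.ResolutionOfSingularities.ResolutionOfSingularities.Theses.HomologicalConductor
open Summit.ResolutionOfSingularities.ResolutionOfSingularities.Theorems.NoZeno.Birth
open Summit.ResolutionOfSingularities.ResolutionOfSingularities.Theorems.NoZeno.SandwichCluster.Parasite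
open Summit.ResolutionOfSingularities.ResolutionOfSingularities.Theorems
open Summit.ResolutionOfSingularities.ResolutionOfSingularities.Theorems.NoZeno
open Literature.AlgebraicGeometry.Resolution
open IsLocalRing Polynomial

variable {k K : Type} [Field k] [Field K] [Algebra k K]

/-! ## The arithmetic of a coarsening -/

/-- **A positive-`O`-value `O₁`-unit is residually transcendental for the coarsening `O₁ ≥ O`**: for `u ∈ O` with `O.valuation u < 1` and
`u⁻¹ ∈ O₁`, every non-zero `f ∈ k[X]` has `O₁.valuation (f u) = 1`.  (Induction on `f`: if `f(0) ≠ 0` then `f(u) ≡ f(0)` is an `O`-unit,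
hence an `O₁`-unit; if `f = X · g` then `v₁(f(u)) = v₁(u) · v₁(g(u)) = v₁(g(u))`.) [folklore] -/
theorem valuation_aeval_eq_one_of_coarsening (O O₁ : ValuationSubring K) (hOO₁ : O ≤ O₁)
    (hk : ∀ c : k, algebraMap k K c ∈ O) {u : K} (hu0 : u ≠ 0) (huO : u ∈ O) (hvu : O.valuation u < 1) (huinv : u⁻¹ ∈ O₁) :
    ∀ f : k[X], f ≠ 0 → O₁.valuation (aeval u f) = 1 := by
  -- `O` as a `k`-subalgebra, to evaluate polynomials inside it
  let OA : Subalgebra k K := { O.toSubring with algebraMap_mem' := fun c => hk c }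
  have hmemO : ∀ g : k[X], aeval u g ∈ O := fun g => (CoarseningLU.aeval_mem_of_mem OA (show u ∈ OA from huO) g :)
  have hvu₁ : O₁.valuation u = 1 := SyzygyFlattening.valuation_eq_one_of_inv_mem O₁ (hOO₁ huO) huinv hu0
  -- induction on the degree
  have key : ∀ n : ℕ, ∀ f : k[X], f.natDegree ≤ n → f ≠ 0 → O₁.valuation (aeval u f) = 1 := by
    intro n
    induction n with
    | zero =>
      intro f hf hf0
      rw [Polynomial.eq_C_of_natDegree_le_zero hf] at hf0 ⊢
      have hc : f.coeff 0 ≠ 0 := fun h => hf0 (by rw [h, map_zero])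
      rw [aeval_C]
      exact SyzygyFlattening.valuation_eq_one_of_inv_mem O₁ (hOO₁ (hk _))
        (by rw [← map_inv₀]; exact hOO₁ (hk _)) (by simpa using hc)
    | succ n ih =>
      intro f hf hf0
      have hdecomp : f = X * f.divX + C (f.coeff 0) := (X_mul_divX_add f).symm
      by_cases hc : f.coeff 0 = 0
      · -- `f = X * g`
        have hg0 : f.divX ≠ 0 := by
          intro h
          apply hf0
          rw [hdecomp, h, hc, mul_zero, map_zero, zero_add]
        have hg : f.divX.natDegree ≤ n := by
          rw [natDegree_divX_eq_natDegree_tsub_one]; omega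
        rw [hdecomp, hc, map_zero, add_zero, map_mul, aeval_X, map_mul, hvu₁, one_mul]
        exact ih f.divX hg hg0
      · -- `f(u) = u g(u) + c` is an `O`-unit
        have hval : O.valuation (aeval u f) = 1 := by
          rw [hdecomp, map_add, map_mul, aeval_X, aeval_C]
          have h1 : O.valuation (algebraMap k K (f.coeff 0)) = 1 :=
            SyzygyFlattening.valuation_eq_one_of_inv_mem O (hk _) (by rw [← map_inv₀]; exact hk _) (by simpa using hc)
          have h2 : O.valuation (u * aeval u f.divX) < O.valuation (algebraMap k K (f.coeff 0)) := by
            rw [h1, map_mul]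
            calc O.valuation u * O.valuation (aeval u f.divX) ≤ O.valuation u * 1 :=
                  mul_le_mul' le_rfl ((O.valuation_le_one_iff _).mpr (hmemO _))
              _ < 1 := by rw [mul_one]; exact hvu
          rw [O.valuation.map_add_eq_of_lt_right h2, h1]
        have hne : aeval u f ≠ 0 := fun h => by rw [h, map_zero] at hval; exact zero_ne_one hval
        have hinvO : (aeval u f)⁻¹ ∈ O := (O.valuation_le_one_iff _).mp (by rw [map_inv₀, hval, inv_one])
        exact SyzygyFlattening.valuation_eq_one_of_inv_mem O₁ (hOO₁ (hmemO f)) (hOO₁ hinvO) hne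
  exact fun f hf0 => key f.natDegree f le_rfl hf0

/-- **Every proper coarsening has a residually transcendental unit**: for `O < O₁` there is `u ∈ O`, `O.valuation u < 1`, `u⁻¹ ∈ O₁`, with
no non-zero `f ∈ k[X]` of positive `O₁`-value at `u` (take `u = s⁻¹` for any `s ∈ O₁ ∖ O`). [folklore] -/
theorem exists_residuallyTranscendental_of_lt (O O₁ : ValuationSubring K) (hk : ∀ c : k, algebraMap k K c ∈ O) (h : O < O₁) :
    ∃ u : K, u ∈ O ∧ O.valuation u < 1 ∧ u⁻¹ ∈ O₁ ∧ ∀ f : k[X], f ≠ 0 → ¬ O₁.valuation (aeval u f) < 1 := by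
  obtain ⟨s, hs₁, hsO⟩ := SetLike.exists_of_lt h
  have hs0 : s ≠ 0 := fun h0 => hsO (h0 ▸ O.zero_mem)
  have huO : s⁻¹ ∈ O := (O.mem_or_inv_mem s).resolve_left hsO
  have hvu : O.valuation s⁻¹ < 1 := Coarsening.valuation_lt_one_of_inv_not_mem O huO (by rwa [inv_inv])
  refine ⟨s⁻¹, huO, hvu, by rwa [inv_inv], fun f hf0 hlt => ?_⟩
  rw [valuation_aeval_eq_one_of_coarsening O O₁ h.le hk (inv_ne_zero hs0) huO hvu (by rwa [inv_inv]) f hf0] at hlt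
  exact lt_irrefl _ hlt

/-- **`F ≥ 1` for a proper coarsening**: `1 ≤ residueTrdeg k O₁` whenever `O < O₁`. [folklore] -/
theorem one_le_residueTrdeg_of_lt (O O₁ : ValuationSubring K) (hk : ∀ c : k, algebraMap k K c ∈ O) (h : O < O₁) :
    1 ≤ residueTrdeg k O₁ (fun c => h.le (hk c)) := by
  have hk₁ : ∀ c : k, algebraMap k K c ∈ O₁ := fun c => h.le (hk c)
  obtain ⟨u, huO, -, -, hu⟩ := exists_residuallyTranscendental_of_lt O O₁ hk h
  have huO₁ : u ∈ O₁ := h.le huO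
  letI := algebraOfMem k O₁ hk₁
  haveI := isScalarTower_algebraOfMem k O₁ hk₁
  have hy := exh_algebraicIndependent_residue O₁ hk₁ huO₁ hu
  have hle := hy.cardinalMk_le_trdeg
  simp only [Cardinal.mk_fintype, Fintype.card_unique, Nat.cast_one] at hle
  exact hle

/-- **THE ARITHMETIC OF THE COARSENING (tr.deg 3).**  For `K/k` finitely generated of transcendence degree `3`, `k ⊆ O < O₁ ≠ K`: EITHER `O₁`
is a DISCRETE VALUATION RING (a prime divisor: `F = 2`), OR `residueTrdeg k O₁ = 1`.  (`1 ≤ F ≤ tr.deg − rat.rk ≤ 2`; `F = 2` is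
Zariski–Samuel VI §14 Thm 31.) [cite: ZariskiSamuel1960, Ch. VI §14, Thm. 31] -/
theorem coarsening_dvr_or_residueTrdeg_eq_one (O O₁ : ValuationSubring K) (hk : ∀ c : k, algebraMap k K c ∈ O)
    (hfg : (⊤ : IntermediateField k K).FG) (htr : Algebra.trdeg k K = 3) (h : O < O₁) (htop : O₁ ≠ ⊤) :
    IsDiscreteValuationRing ↥O₁ ∨ residueTrdeg k O₁ (fun c => h.le (hk c)) = 1 := by
  have hk₁ : ∀ c : k, algebraMap k K c ∈ O₁ := fun c => h.le (hk c)
  have hN : Algebra.trdeg k K < Cardinal.aleph0 := by rw [htr]; exact Cardinal.natCast_lt_aleph0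
  obtain ⟨f, hf⟩ := Cardinal.lt_aleph0.mp (residueTrdeg_lt_aleph0 O₁ hk₁ hN)
  obtain ⟨e, he⟩ := Cardinal.lt_aleph0.mp (ratRank_lt_aleph0 O₁ hk₁ hN)
  have h1 : 1 ≤ f := by have := one_le_residueTrdeg_of_lt O O₁ hk h; rw [hf] at this; exact_mod_cast this
  have he1 : 1 ≤ e := by have := one_le_ratRank_of_ne_top O₁ htop; rw [he] at this; exact_mod_cast this
  have hsum : e + f ≤ 3 := by
    have := ratRank_add_residueTrdeg_le_trdeg O₁ hk₁
    rw [he, hf, htr] at this; exact_mod_cast this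
  by_cases hf2 : f = 2
  · left
    refine isDiscreteValuationRing_of_residueTrdeg O₁ hk₁ hfg htop ?_
    rw [hf, htr, hf2]; norm_num
  · right
    rw [hf]
    have : f = 1 := by omega
    exact_mod_cast this

/-! ## No chain inside a noetherian subring; no chain after a regular stage -/

/-- **No infinite strictly value-decreasing sequence inside a noetherian subring of `O`** (the ascending-chain argument of THM NC,
`NoetherianCapture.terminates_of_noetherianCapture`): if `z n ∈ N ∖ 0`, `N ⊆ O` noetherian, and `z n / z (n+1) ∈ O` for all `n`, then
`z (n+1) / z n ∈ O` for some `n`. [folklore] -/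
theorem exists_valueRise_of_noetherian (O : ValuationSubring K) (N : Subring K) (hN : IsNoetherianRing ↥N) (hNO : N ≤ O.toSubring)
    (z : ℕ → K) (hzN : ∀ n, z n ∈ N) (hz0 : ∀ n, z n ≠ 0) (hdiv : ∀ n, z n * (z (n + 1))⁻¹ ∈ O) :
    ∃ n, z (n + 1) * (z n)⁻¹ ∈ O := by
  classical
  let I : ℕ → Ideal ↥N := fun n =>
    { carrier := {x | (x : K) * (z n)⁻¹ ∈ O}
      add_mem' := fun {a b} ha hb => by
        simp only [Set.mem_setOf_eq, Subring.coe_add, add_mul] at ha hb ⊢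
        exact O.add_mem _ _ ha hb
      zero_mem' := by simp only [Set.mem_setOf_eq, Subring.coe_zero, zero_mul]; exact O.zero_mem
      smul_mem' := fun c {x} hx => by
        simp only [Set.mem_setOf_eq, smul_eq_mul, Subring.coe_mul, mul_assoc] at hx ⊢
        exact O.mul_mem _ _ (hNO c.2) hx }
  have hmono : Monotone I := monotone_nat_of_le_succ fun n => fun x hx => by
    change (x : K) * (z (n + 1))⁻¹ ∈ O
    have hx' : (x : K) * (z n)⁻¹ ∈ O := hx
    have : (x : K) * (z (n + 1))⁻¹ = ((x : K) * (z n)⁻¹) * (z n * (z (n + 1))⁻¹) := by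
      rw [mul_assoc, inv_mul_cancel_left₀ (hz0 n)]
    rw [this]; exact O.mul_mem _ _ hx' (hdiv n)
  haveI : IsNoetherian ↥N ↥N := hN
  obtain ⟨n, hn⟩ := monotone_stabilizes_iff_noetherian.2 ‹IsNoetherian ↥N ↥N› ⟨I, hmono⟩
  have hmem : (⟨z (n + 1), hzN (n + 1)⟩ : ↥N) ∈ I (n + 1) := by
    change z (n + 1) * (z (n + 1))⁻¹ ∈ O
    rw [mul_inv_cancel₀ (hz0 _)]; exact O.one_mem
  have hn' : I n = I (n + 1) := hn (n + 1) (Nat.le_succ n)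
  rw [← hn'] at hmem
  exact ⟨n, hmem⟩

/-- **After a regular stage there is no `ca`-Zeno chain** (for any `U`): a chain drawn from the `ca`'s of stages `≥ m`, `T_m` regular, lives
in the noetherian ring `T_m` (the tower is stationary), where strictly value-decreasing sequences are finite. [this work] -/
theorem noChain_of_isRegularLocalRing_tower (O : ValuationSubring K) (A : Subalgebra k K)
    (hk : ∀ c : k, algebraMap k K c ∈ O) (hA : A.FG) (hfr : IsFractionRing ↥A K) (hAO : A.toSubring ≤ O.toSubring)
    (m : ℕ) (hreg : IsRegularLocalRing ↥(tower O A m)) (U : ValuationSubring K) :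
    ¬ ∃ z : ℕ → K, (∀ n : ℕ, (∃ m' : ℕ, m ≤ m' ∧ z n ∈ ca (tower O A m')) ∧ z n ≠ 0 ∧ (z n)⁻¹ ∈ U) ∧
      (∀ n : ℕ, z n * (z (n + 1))⁻¹ ∈ O) ∧ ∀ n : ℕ, z (n + 1) * (z n)⁻¹ ∉ O := by
  rintro ⟨z, hz, hdiv, hsep⟩
  have hzT : ∀ n, z n ∈ (tower O A m).toSubring := fun n => by
    obtain ⟨⟨m', hm', hca⟩, -, -⟩ := hz n
    have := ca_subset _ hca
    rw [NoetherianCapture.tower_eq_of_le_of_isRegularLocalRing O A hk hfr hAO m hreg m' hm'] at this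
    exact this
  obtain ⟨n, hn⟩ := exists_valueRise_of_noetherian O (tower O A m).toSubring (stub_towerNoetherian k K O A hk hA hfr hAO m)
    (fun x hx => TraceSocle.stage_le O A hk hAO m x hx) z hzT (fun n => (hz n).2.1) hdiv
  exact hsep n hn

/-! ## The closed half: discrete socle -/

/-- **E3's CONCLUSION FROM A DISCRETE SOCLE (PROVED HALF).**  Over E3's working binders (`PersistenceRadical`, `StrictDrop`, the datum, the
maximality binder `hmax`, threadlessness, a proper coarsening `O₁ ≠ K`): if SOME coarsening `U > O` has the descending chain condition on the
`O`-values of its units, the tower terminates (`Coarsening.kernelThreadless_of_discreteCoarsening`) and from the regular stage on there is no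
`ca`-Zeno chain in the `O₁`-units. [this work] -/
theorem e3Conclusion_of_discreteSocle (hP : PersistenceRadical) (hD : StrictDrop) (p : ℕ) (hp : p.Prime)
    (k K : Type) [Field k] [CharP k p] [Field K] [Algebra k K] (O : ValuationSubring K) (A : Subalgebra k K)
    (hk : ∀ c : k, algebraMap k K c ∈ O) (hA : A.FG) (hfr : IsFractionRing ↥A K) (hAO : A.toSubring ≤ O.toSubring)
    (hmax : ∀ O' : ValuationSubring K, O < O' → ∃ m : ℕ, ∃ s ∈ tower O A m, s⁻¹ ∈ O' ∧ s⁻¹ ∉ O)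
    (hO₁ : ∃ O₁ : ValuationSubring K, O < O₁ ∧ O₁ ≠ ⊤) (hthr : ¬ SingularPrimeThread O A)
    (hsocle : ∃ U : ValuationSubring K, O < U ∧ ∀ z : ℕ → K, (∀ n : ℕ, z n ∈ O ∧ z n ≠ 0 ∧ (z n)⁻¹ ∈ U) →
      (∀ n : ℕ, z n * (z (n + 1))⁻¹ ∈ O) → ∃ n : ℕ, z (n + 1) * (z n)⁻¹ ∈ O) :
    ∃ O₁ : ValuationSubring K, O < O₁ ∧ O₁ ≠ ⊤ ∧ ∃ m₀ : ℕ, ¬ ∃ z : ℕ → K,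
      (∀ n : ℕ, (∃ m : ℕ, m₀ ≤ m ∧ z n ∈ ca (tower O A m)) ∧ z n ≠ 0 ∧ (z n)⁻¹ ∈ O₁) ∧
      (∀ n : ℕ, z n * (z (n + 1))⁻¹ ∈ O) ∧ ∀ n : ℕ, z (n + 1) * (z n)⁻¹ ∉ O := by
  obtain ⟨U, hOU, hacc⟩ := hsocle
  obtain ⟨m, hm⟩ := Coarsening.kernelThreadless_of_discreteCoarsening hP hD p hp k K O A hk hA hfr hAO hmax hthr U hOU hacc
  obtain ⟨O₁, hlt, htop⟩ := hO₁
  exact ⟨O₁, hlt, htop, m, noChain_of_isRegularLocalRing_tower O A hk hA hfr hAO m hm O₁⟩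


/-! ## TEXT LEVEL: `E3` from `E3⁺` (non-discrete socle + the arithmetic of the coarsening) -/

/-- **`E3` FROM `E3⁺`.**  `h` = E3⁺ := the `E3` text of `…NoZenoCompositeSplit` (binder `h3` of `noCaZenoChainSharp_of_split`) with the
ground-field binder NAMED (`hk`) and two clauses inserted after the coarsening binder: (nd) NON-DISCRETE SOCLE — every proper coarsening
`U > O` carries an infinite strictly value-decreasing sequence of `U`-units of `O` (else `e3Conclusion_of_discreteSocle` closes the datum);
(ar) the ARITHMETIC — every proper non-noetherian coarsening `O₁ ≠ K` has `residueTrdeg k O₁ = 1` (free, `coarsening_dvr_or_residueTrdeg_eq_one`).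
The conclusion is `E3` verbatim.  So the slot-3 residual of record is {H, E3⁺}: «`O = O₁ ∘ Ō` on a threefold with NON-DISCRETE socle
(`O₁` a prime divisor `E` with `Ō` non-discrete on `κ(E)`, or `O₁` rank one non-discrete with a curve residue field), exhausting,
threadless ⊢ no `ca`-Zeno chain in the `O₁`-units». [this work] -/
theorem noCaZenoChainSharp3_of_socleSplit
    (h :
      PersistenceRadical → StrictDrop → ∀ p : ℕ, p.Prime → ∀ (k K : Type) [Field k] [CharP k p] [Field K]
        [Algebra k K] (O : ValuationSubring K) (A : Subalgebra k K) (hk : ∀ c : k, algebraMap k K c ∈ O),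
        A.FG → IsFractionRing ↥A K → A.toSubring ≤ O.toSubring →
        (∀ O' : ValuationSubring K,
          (∀ m : ℕ, ∀ s ∈ tower O A m, s ∈ O' ∧ (s⁻¹ ∈ O' → s⁻¹ ∈ O)) → ¬ IsNoetherianRing ↥O') →
        (∀ O' : ValuationSubring K, O < O' → ∃ m : ℕ, ∃ s ∈ tower O A m, s⁻¹ ∈ O' ∧ s⁻¹ ∉ O) →
        (∀ (k' K' : Type) [Field k'] [CharP k' p] [Field K'] [Algebra k' K'] (O' : ValuationSubring K')
          (A' : Subalgebra k' K'), (∀ c : k', algebraMap k' K' c ∈ O') → A'.FG → IsFractionRing ↥A' K' →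
          A'.toSubring ≤ O'.toSubring → Algebra.trdeg k' K' < Algebra.trdeg k K →
          ∃ m : ℕ, IsRegularLocalRing ↥(tower O' A' m)) →
        (∀ m : ℕ, ∀ s ∈ tower O A m, ∃ f : Polynomial k, f ≠ 0 ∧ O.valuation (Polynomial.aeval s f) < 1) →
        Algebra.trdeg k K = 3 →
        (∃ O₁ : ValuationSubring K, O < O₁ ∧ O₁ ≠ ⊤) →
        (∀ U : ValuationSubring K, O < U → ∃ z : ℕ → K, (∀ n : ℕ, z n ∈ O ∧ z n ≠ 0 ∧ (z n)⁻¹ ∈ U) ∧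
          (∀ n : ℕ, z n * (z (n + 1))⁻¹ ∈ O) ∧ ∀ n : ℕ, z (n + 1) * (z n)⁻¹ ∉ O) →
        (∀ (O₁ : ValuationSubring K) (h₁ : O < O₁), O₁ ≠ ⊤ → ¬ IsNoetherianRing ↥O₁ →
          residueTrdeg k O₁ (fun c => h₁.le (hk c)) = 1) →
        (∀ x : K, x ∈ O → ∃ m : ℕ, x ∈ tower O A m) →
        ¬ SingularPrimeThread O A →
        ∃ O₁ : ValuationSubring K, O < O₁ ∧ O₁ ≠ ⊤ ∧ ∃ m₀ : ℕ, ¬ ∃ z : ℕ → K,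
          (∀ n : ℕ, (∃ m : ℕ, m₀ ≤ m ∧ z n ∈ ca (tower O A m)) ∧ z n ≠ 0 ∧ (z n)⁻¹ ∈ O₁) ∧
          (∀ n : ℕ, z n * (z (n + 1))⁻¹ ∈ O) ∧ ∀ n : ℕ, z (n + 1) * (z n)⁻¹ ∉ O) :
    PersistenceRadical → StrictDrop → ∀ p : ℕ, p.Prime → ∀ (k K : Type) [Field k] [CharP k p] [Field K]
      [Algebra k K] (O : ValuationSubring K) (A : Subalgebra k K), (∀ c : k, algebraMap k K c ∈ O) →
      A.FG → IsFractionRing ↥A K → A.toSubring ≤ O.toSubring →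
      (∀ O' : ValuationSubring K,
        (∀ m : ℕ, ∀ s ∈ tower O A m, s ∈ O' ∧ (s⁻¹ ∈ O' → s⁻¹ ∈ O)) → ¬ IsNoetherianRing ↥O') →
      (∀ O' : ValuationSubring K, O < O' → ∃ m : ℕ, ∃ s ∈ tower O A m, s⁻¹ ∈ O' ∧ s⁻¹ ∉ O) →
      (∀ (k' K' : Type) [Field k'] [CharP k' p] [Field K'] [Algebra k' K'] (O' : ValuationSubring K')
        (A' : Subalgebra k' K'), (∀ c : k', algebraMap k' K' c ∈ O') → A'.FG → IsFractionRing ↥A' K' →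
        A'.toSubring ≤ O'.toSubring → Algebra.trdeg k' K' < Algebra.trdeg k K →
        ∃ m : ℕ, IsRegularLocalRing ↥(tower O' A' m)) →
      (∀ m : ℕ, ∀ s ∈ tower O A m, ∃ f : Polynomial k, f ≠ 0 ∧ O.valuation (Polynomial.aeval s f) < 1) →
      Algebra.trdeg k K = 3 →
      (∃ O₁ : ValuationSubring K, O < O₁ ∧ O₁ ≠ ⊤) →
      (∀ x : K, x ∈ O → ∃ m : ℕ, x ∈ tower O A m) →
      ¬ SingularPrimeThread O A →
      ∃ O₁ : ValuationSubring K, O < O₁ ∧ O₁ ≠ ⊤ ∧ ∃ m₀ : ℕ, ¬ ∃ z : ℕ → K,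
        (∀ n : ℕ, (∃ m : ℕ, m₀ ≤ m ∧ z n ∈ ca (tower O A m)) ∧ z n ≠ 0 ∧ (z n)⁻¹ ∈ O₁) ∧
        (∀ n : ℕ, z n * (z (n + 1))⁻¹ ∈ O) ∧ ∀ n : ℕ, z (n + 1) * (z n)⁻¹ ∉ O := by
  intro hP hD p hp k K _ _ _ _ O A hk hA hfr hAO hker hmax IH hzd htr hO₁ hexh hthr
  by_cases hsocle : ∃ U : ValuationSubring K, O < U ∧ ∀ z : ℕ → K, (∀ n : ℕ, z n ∈ O ∧ z n ≠ 0 ∧ (z n)⁻¹ ∈ U) →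
      (∀ n : ℕ, z n * (z (n + 1))⁻¹ ∈ O) → ∃ n : ℕ, z (n + 1) * (z n)⁻¹ ∈ O
  · exact e3Conclusion_of_discreteSocle hP hD p hp k K O A hk hA hfr hAO hmax hO₁ hthr hsocle
  · have hnd : ∀ U : ValuationSubring K, O < U → ∃ z : ℕ → K, (∀ n : ℕ, z n ∈ O ∧ z n ≠ 0 ∧ (z n)⁻¹ ∈ U) ∧
        (∀ n : ℕ, z n * (z (n + 1))⁻¹ ∈ O) ∧ ∀ n : ℕ, z (n + 1) * (z n)⁻¹ ∉ O := by
      intro U hU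
      by_contra hno
      push Not at hno
      exact hsocle ⟨U, hU, hno⟩
    haveI := hfr
    haveI : Algebra.FiniteType k ↥A := A.fg_iff_finiteType.mp hA
    have hfg : (⊤ : IntermediateField k K).FG := IntermediateField.fg_top_of_isFractionRing_of_finiteType k ↥A K
    have har : ∀ (O₁ : ValuationSubring K) (h₁ : O < O₁), O₁ ≠ ⊤ → ¬ IsNoetherianRing ↥O₁ →
        residueTrdeg k O₁ (fun c => h₁.le (hk c)) = 1 := by
      intro O₁ h₁ htop hnn
      rcases coarsening_dvr_or_residueTrdeg_eq_one O O₁ hk hfg htr h₁ htop with hdvr | hF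
      · haveI := hdvr
        exact absurd (inferInstance : IsNoetherianRing ↥O₁) hnn
      · exact hF
    exact h hP hD p hp k K O A hk hA hfr hAO hker hmax IH hzd htr hO₁ hnd har hexh hthr

end Summit.ResolutionOfSingularities.ResolutionOfSingularities.Theorems.NoZeno.CompositeSplit

end
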